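/-
M17a (decomp-mm-lens-5 g30) — SYMMETRY UNTWISTING FOR RUNG `K = 2` OF BOP′.
The base-translation symmetry `τ_δ` of the graph moves TESTS, not points: the translate `t ∘ τ_δ`
is again in `I`, needs no kernel field and no correction, and its row over `y` is the row of `t`
over `y + δ`.  Adjoining finitely many translates shrinks `ker J_C(graphPoint y)` to the global
tangent space (FINITE FLATTENING, `≤ n²` translates always suffice), after which the flat-class
deflation R1 of M16a applies.  No sorry.
-/
import Mathlib
import Summits.MatrixMultiplication.Statement
import Summits.MatrixMultiplication.MatrixMultiplication.Theorems.GraphEquationsCorrectedDeflation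

/-!
# Graph equations — untwisting by the translation symmetry of the graph

Supporting kernels for the crux `MultiplicityReduction` of route `GraphEquations`
(line `purisplit`, stub `BoundedOrderPurification`, rung `K = 2`:
`EqAdmissibleIdealIso β 2 → EqAdmissiblePure β'` for `2 ≤ β < β'`).

M16a–d (g29) left rung `2` resting on the windowed residual `HiddenTwistedCorrDeflation K₀ β β'`:
a demand, on every HIDDEN ∧ TWISTED ∧ non-row-split order-`2` pair `(E, y)`, for a cheap
(kernel field, correction) pair.  A pair is TWISTED when its deflation directions at `y` are not
GLOBAL tangent vectors (`EqSystem.FlatAt` fails and no constant field deflates).  This file adds a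
FREE MOVE that untwists:

* **Translation symmetry** (`translate δ t = t ∘ τ_δ`, the tree shift `θ_x` at the graph point
  `x = graphPoint δ`, `τ_δ (A,B,C) = (A + A₁, B + B₁, C + A₁B + AB₁ + A₁B₁)` for `δ = (A₁,B₁)`):
  `τ_δ` is an automorphism of `W_n`, so `translate δ` preserves `I` (`translate_mem_graphIdeal`),
  fixes every `f_q` in `Ψ`-coordinates (tree `bind₁_shift_substF`: it acts on COEFFICIENTS only),
  commutes with `∂/∂c_q` (tree `pderiv_inr_bind₁_shift`), and therefore
  **the row of `t ∘ τ_δ` over `y` is the row of `t` over `y + δ`**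
  (`eval_graphPoint_pderiv_inr_translate`, `rowEval_translate`).  Unlike a kernel-field derivative
  `D_μ t`, a translate needs NO field and NO correction to stay in `I`.
* **Translated systems** (`EqSystem.TranslatesTo E Δ E'`: the tests of `E'` are the tests of `E`
  and their `Δ`-translates, nothing else): correct if `E` is (`TranslatesTo.correct`), order of
  ideal isolation preserved (`TranslatesTo.idealInitIsolatedAt`), the SAME global tangent vectors
  (`TranslatesTo.globalTangent_iff`), and `ker J_C(E')(graphPoint y) = N(y) ∩ ⋂_{δ ∈ Δ} N(y + δ)`
  (`TranslatesTo.jacobianC_mulVec_eq_zero_iff`), `N(y') = ker J_C(E)(graphPoint y')`.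
* **FINITE FLATTENING** (`EqSystem.exists_flattening`): for every `E` and `y` there is a list `Δ`
  of at most `n²` base translations with `N(y) ∩ ⋂_{δ ∈ Δ} N(y + δ) = ` the global tangent space
  (`EqSystem.Flattens`; descending chain of subspaces of `ℂ^{n²}`).  Hence every translated system
  `E'` along a flattening list is FLAT over `y` (`TranslatesTo.flatAt`), and
* **R1 on UNTWISTED systems** (`exists_reduced_deflation_of_translatesTo`, `untwisting`): a
  correct pair `(E, y)` with test ideal initially isolated to order `2` has, for ANY fan-in-two
  system `E'` realising the translates along a flattening list, a correct deflation reduced at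
  `graphPoint y` of cost `≤ 4·cost E' + n²` (M16a `exists_reduced_deflation_of_flatAt`).

So twisting is never an obstruction in principle — only the COST of the translates is (a generic
translate costs a copy of `E` plus an input substitution; `n²` of them are too many).  The class of
pairs flattened by BOUNDEDLY MANY SPARSE translates is carved out in M17b
(`GraphEquationsUntwistingResidual`).  Examples: the hidden ∧ twisted pair of M16a
(`{a₁₁ f₁₁, f₂₁ + f₁₁², f₂₁, f₁₂², f₂₂}` over `a₁₁(y) = 0`) and the non-row-split toy of the g29
critic (`{t = f₁₁ + a₁₁ f₁₂ + f₂₁², b₁₁ t + f₁₂², f₂₁², f₂₂²}`) are both flattened by the ONE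
translate `δ = e_{a₁₁}` (support `1`): `(a₁₁ + 1) f₁₁ − a₁₁ f₁₁ = f₁₁`, resp. `t ∘ τ_δ − t = f₁₂`,
lie in the translated test ideal.

References: BCS97 Problem 16.3 (verification complexity of matrix multiplication; graph `W_n`);
the translation automorphism is M14a's `θ_x` (`GraphEquationsCostRank`, `GraphEquationsInitialIdeal`).
-/

-- dupNamespace: forced by the nested Summit.MatrixMultiplication.MatrixMultiplication layout (D-0017)
set_option linter.dupNamespace false

noncomputable section

open scoped BigOperators

namespace Summit.MatrixMultiplication.MatrixMultiplication.Theorems.GraphEquations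

open MvPolynomial Literature.Computability.AlgebraicComplexity
open Literature.Computability.AlgebraicComplexity.ArithCircuit

variable {n : ℕ}

/-! ## The translation symmetry acting on tests -/

/-- The TRANSLATE `t ∘ τ_δ` of a polynomial `t ∈ ℂ[A,B,C]` by the base translation `δ = (A₁, B₁)`:
`τ_δ (A,B,C) = (A + A₁, B + B₁, C + A₁B + AB₁ + A₁B₁)`, i.e. the tree shift `θ_x` at the graph point
`x = graphPoint δ`. -/
def translate (δ : MatMulVars n → ℂ) (t : MvPolynomial (GraphVars n) ℂ) : MvPolynomial (GraphVars n) ℂ :=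
  bind₁ (shift (graphPoint δ)) t

/-- `translate δ` is the algebra map `bind₁ (shift (graphPoint δ))` (definitional). -/
theorem translate_eq (δ : MatMulVars n → ℂ) (t : MvPolynomial (GraphVars n) ℂ) :
    translate δ t = bind₁ (shift (graphPoint δ)) t := rfl

/-- `translate δ` is additive. -/
theorem translate_add (δ : MatMulVars n → ℂ) (t u : MvPolynomial (GraphVars n) ℂ) :
    translate δ (t + u) = translate δ t + translate δ u := map_add _ _ _

/-- `translate δ` is multiplicative. -/
theorem translate_mul (δ : MatMulVars n → ℂ) (t u : MvPolynomial (GraphVars n) ℂ) :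
    translate δ (t * u) = translate δ t * translate δ u := map_mul _ _ _

/-- `translate δ` fixes constants. -/
@[simp] theorem translate_C (δ : MatMulVars n → ℂ) (c : ℂ) :
    translate δ (C c : MvPolynomial (GraphVars n) ℂ) = C c := by
  simp [translate]

/-- **`translate δ ∘ Ψ = Ψ ∘ map τ_δ`**: in `Ψ`-coordinates the translation acts on the
COEFFICIENTS `g(a,b) ↦ g(a + A₁, b + B₁)` only and fixes every `F_q` (tree `bind₁_shift_substF`). -/
theorem translate_substF (δ : MatMulVars n → ℂ) (G : FPoly n) :
    translate δ (substF n G) = substF n (map (shiftAB δ) G) :=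
  bind₁_shift_substF δ G

/-- `translate δ` fixes the generators `f_q`. -/
theorem translate_generator (δ : MatMulVars n → ℂ) (q : Fin n × Fin n) :
    translate δ (generator n q) = generator n q :=
  bind₁_shift_generator (graphPoint_mem_mmGraph δ) q

/-- **`τ_δ` maps the graph point over `y` to the graph point over `y + δ`.** -/
theorem shiftPoint_graphPoint_graphPoint (δ y : MatMulVars n → ℂ) :
    shiftPoint (graphPoint δ) (graphPoint y) = graphPoint (y + δ) := by
  funext v
  rcases v with v | ⟨i, l⟩
  · simp [shiftPoint, shift, graphPoint]
  · simp only [shiftPoint, shift, graphPoint, map_add, map_sum, MvPolynomial.eval_X,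
      MvPolynomial.eval_C, MvPolynomial.smul_eval, Pi.add_apply]
    rw [← Finset.sum_add_distrib, ← Finset.sum_add_distrib]
    refine Finset.sum_congr rfl fun j _ => ?_
    ring

/-- Evaluating a translate: `(t ∘ τ_δ)(x) = t(τ_δ x)`. -/
theorem eval_translate (δ : MatMulVars n → ℂ) (x : GraphVars n → ℂ) (t : MvPolynomial (GraphVars n) ℂ) :
    eval x (translate δ t) = eval (shiftPoint (graphPoint δ) x) t :=
  eval_bind₁_shift _ _ _

/-- **Evaluating a translate at a graph point**: `(t ∘ τ_δ)(graphPoint y) = t(graphPoint (y + δ))`. -/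
theorem eval_graphPoint_translate (δ y : MatMulVars n → ℂ) (t : MvPolynomial (GraphVars n) ℂ) :
    eval (graphPoint y) (translate δ t) = eval (graphPoint (y + δ)) t := by
  rw [eval_translate, shiftPoint_graphPoint_graphPoint]

/-- **Translates stay in `I`** (no kernel field, no correction needed): `τ_δ` preserves `W_n`. -/
theorem translate_mem_graphIdeal (δ : MatMulVars n → ℂ) {t : MvPolynomial (GraphVars n) ℂ}
    (ht : t ∈ graphIdeal n) : translate δ t ∈ graphIdeal n :=
  mem_graphIdeal_of_vanishing fun x hx => by
    rw [eval_translate]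
    exact eval_eq_zero_of_mem_graphIdeal ht (shiftPoint_mem_mmGraph (graphPoint_mem_mmGraph δ) hx)

/-- `∂/∂c_q` commutes with translation (tree `pderiv_inr_bind₁_shift`). -/
theorem pderiv_inr_translate (δ : MatMulVars n → ℂ) (q : Fin n × Fin n)
    (t : MvPolynomial (GraphVars n) ℂ) :
    pderiv (Sum.inr q) (translate δ t) = translate δ (pderiv (Sum.inr q) t) :=
  pderiv_inr_bind₁_shift _ q t

/-- **THE ROW OF A TRANSLATE over `y` IS THE ROW OF THE TEST over `y + δ`**:
`(∂(t ∘ τ_δ)/∂c_q)(graphPoint y) = (∂t/∂c_q)(graphPoint (y + δ))`. -/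
theorem eval_graphPoint_pderiv_inr_translate (δ y : MatMulVars n → ℂ) (q : Fin n × Fin n)
    (t : MvPolynomial (GraphVars n) ℂ) :
    eval (graphPoint y) (pderiv (Sum.inr q) (translate δ t)) =
      eval (graphPoint (y + δ)) (pderiv (Sum.inr q) t) := by
  rw [pderiv_inr_translate, eval_graphPoint_translate]

/-- The same identity for the specialised linear part of `Ψ⁻¹`: the row of `t ∘ τ_δ` specialised at
`y`, paired with `γ`, is the row of `t` specialised at `y + δ`, paired with `γ`. -/
theorem rowEval_translate (δ y : MatMulVars n → ℂ) (γ : Fin n × Fin n → ℂ)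
    (t : MvPolynomial (GraphVars n) ℂ) :
    eval γ (map (eval y) (homogeneousComponent 1 (liftF n (translate δ t)))) =
      eval γ (map (eval (y + δ)) (homogeneousComponent 1 (liftF n t))) := by
  rw [eval_map_homogeneousComponent_one_liftF, eval_map_homogeneousComponent_one_liftF]
  simp_rw [eval_graphPoint_pderiv_inr_translate]

/-- **Constant kernel fields commute with translation**: `D_γ (t ∘ τ_δ) = (D_γ t) ∘ τ_δ` for a
CONSTANT field `γ` — so translates keep every global tangent vector. -/
theorem derivC_const_translate (γ : Fin n × Fin n → ℂ) (δ : MatMulVars n → ℂ)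
    (t : MvPolynomial (GraphVars n) ℂ) :
    derivC (fun q => C (γ q)) (translate δ t) = translate δ (derivC (fun q => C (γ q)) t) := by
  unfold derivC translate
  rw [map_sum]
  refine Finset.sum_congr rfl fun q _ => ?_
  rw [map_mul, liftAB_C, bind₁_C_right, pderiv_inr_bind₁_shift]

namespace EqSystem

/-! ## Translated systems -/

/-- **`E'` REALISES THE `Δ`-TRANSLATES OF `E`**: the tests of `E'` are the tests of `E` and their
translates `t ∘ τ_δ`, `δ ∈ Δ` — and nothing else. -/
def TranslatesTo (E : EqSystem n) (Δ : List (MatMulVars n → ℂ)) (E' : EqSystem n) : Prop :=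
  (∀ j ∈ E.tests, ∃ j' ∈ E'.tests, E'.testPoly j' = E.testPoly j) ∧
  (∀ δ ∈ Δ, ∀ j ∈ E.tests, ∃ j' ∈ E'.tests, E'.testPoly j' = translate δ (E.testPoly j)) ∧
  (∀ j' ∈ E'.tests, (∃ j ∈ E.tests, E'.testPoly j' = E.testPoly j) ∨
    ∃ δ ∈ Δ, ∃ j ∈ E.tests, E'.testPoly j' = translate δ (E.testPoly j))

/-- `E` realises its own (empty list of) translates. -/
theorem TranslatesTo.nil (E : EqSystem n) : E.TranslatesTo [] E :=
  ⟨fun j hj => ⟨j, hj, rfl⟩, fun _ h => by simp at h, fun j' hj' => Or.inl ⟨j', hj', rfl⟩⟩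

/-- The tests of a correct system lie in `I`. -/
theorem Correct.testPoly_mem_graphIdeal' {E : EqSystem n} (hE : E.Correct) {j : ℕ} (hj : j ∈ E.tests) :
    E.testPoly j ∈ graphIdeal n :=
  mem_graphIdeal_of_vanishing fun _ hx => hE.eval_testPoly_eq_zero hx hj

/-- **A translated system of a correct system is correct** (given fan-in two). -/
theorem TranslatesTo.correct {E E' : EqSystem n} {Δ : List (MatMulVars n → ℂ)} (h : E.TranslatesTo Δ E')
    (hE : E.Correct) (hfan : E'.circuit.IsFanInTwo) : E'.Correct :=
  hE.of_contains hfan h.1 fun j' hj' => by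
    rcases h.2.2 j' hj' with ⟨j, hj, he⟩ | ⟨δ, _, j, hj, he⟩
    · rw [he]; exact hE.testPoly_mem_graphIdeal' hj
    · rw [he]; exact translate_mem_graphIdeal δ (hE.testPoly_mem_graphIdeal' hj)

/-- The test set only grows. -/
theorem TranslatesTo.span_testSet_le {E E' : EqSystem n} {Δ : List (MatMulVars n → ℂ)}
    (h : E.TranslatesTo Δ E') : Ideal.span E.testSet ≤ Ideal.span E'.testSet :=
  Ideal.span_mono fun t ht => by
    obtain ⟨j, hj, rfl⟩ := (E.mem_testSet_iff t).mp ht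
    obtain ⟨j', hj', he⟩ := h.1 j hj
    exact (E'.mem_testSet_iff _).mpr ⟨j', hj', he⟩

/-- **Translation preserves the order of ideal isolation** (the test ideal only grows). -/
theorem TranslatesTo.idealInitIsolatedAt {E E' : EqSystem n} {Δ : List (MatMulVars n → ℂ)}
    (h : E.TranslatesTo Δ E') {K : ℕ} {y : MatMulVars n → ℂ} (hiso : E.IdealInitIsolatedAt K y) :
    E'.IdealInitIsolatedAt K y :=
  (E'.idealInitIsolatedAt_iff K y).mpr (((E.idealInitIsolatedAt_iff K y).mp hiso).mono h.span_testSet_le)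

/-- **`ker J_C(E')(graphPoint y) = N(y) ∩ ⋂_{δ ∈ Δ} N(y + δ)`**, `N(y') = ker J_C(E)(graphPoint y')`. -/
theorem TranslatesTo.jacobianC_mulVec_eq_zero_iff {E E' : EqSystem n} {Δ : List (MatMulVars n → ℂ)}
    (h : E.TranslatesTo Δ E') (y : MatMulVars n → ℂ) (γ : Fin n × Fin n → ℂ) :
    (E'.jacobianC (graphPoint y)).mulVec γ = 0 ↔
      (E.jacobianC (graphPoint y)).mulVec γ = 0 ∧
        ∀ δ ∈ Δ, (E.jacobianC (graphPoint (y + δ))).mulVec γ = 0 := by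
  simp only [jacobianC_graphPoint_mulVec_eq_zero_iff]
  constructor
  · intro h'
    refine ⟨fun j hj => ?_, fun δ hδ j hj => ?_⟩
    · obtain ⟨j', hj', he⟩ := h.1 j hj
      rw [← he]; exact h' j' hj'
    · obtain ⟨j', hj', he⟩ := h.2.1 δ hδ j hj
      rw [← rowEval_translate, ← he]; exact h' j' hj'
  · rintro ⟨h0, hΔ⟩ j' hj'
    rcases h.2.2 j' hj' with ⟨j, hj, he⟩ | ⟨δ, hδ, j, hj, he⟩
    · rw [he]; exact h0 j hj
    · rw [he, rowEval_translate]; exact hΔ δ hδ j hj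

/-- **Translation keeps exactly the global tangent vectors.** -/
theorem TranslatesTo.globalTangent_iff {E E' : EqSystem n} {Δ : List (MatMulVars n → ℂ)}
    (h : E.TranslatesTo Δ E') (γ : Fin n × Fin n → ℂ) : E'.GlobalTangent γ ↔ E.GlobalTangent γ :=
  ⟨fun hG y => ((h.jacobianC_mulVec_eq_zero_iff y γ).mp (hG y)).1,
    fun hG y => (h.jacobianC_mulVec_eq_zero_iff y γ).mpr ⟨hG y, fun δ _ => hG (y + δ)⟩⟩

/-! ## Flattening lists -/

/-- **`Δ` FLATTENS `E` over `y`**: `N(y) ∩ ⋂_{δ ∈ Δ} N(y + δ)` consists of global tangent vectors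
(the reverse inclusion always holds). `Δ = []` is `FlatAt`. -/
def Flattens (E : EqSystem n) (y : MatMulVars n → ℂ) (Δ : List (MatMulVars n → ℂ)) : Prop :=
  ∀ γ : Fin n × Fin n → ℂ, (E.jacobianC (graphPoint y)).mulVec γ = 0 →
    (∀ δ ∈ Δ, (E.jacobianC (graphPoint (y + δ))).mulVec γ = 0) → E.GlobalTangent γ

/-- `Flattens y []` is `FlatAt y`. -/
theorem flattens_nil_iff (E : EqSystem n) (y : MatMulVars n → ℂ) : E.Flattens y [] ↔ E.FlatAt y :=
  ⟨fun h γ hγ => h γ hγ fun _ hδ => by simp at hδ, fun h γ hγ _ => h γ hγ⟩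

/-- Flattening is monotone in the list. -/
theorem Flattens.mono {E : EqSystem n} {y : MatMulVars n → ℂ} {Δ Δ' : List (MatMulVars n → ℂ)}
    (h : E.Flattens y Δ) (hΔ : Δ ⊆ Δ') : E.Flattens y Δ' :=
  fun γ hγ hΔ' => h γ hγ fun δ hδ => hΔ' δ (hΔ hδ)

/-- **A system translated along a flattening list is FLAT over `y`.** -/
theorem TranslatesTo.flatAt {E E' : EqSystem n} {Δ : List (MatMulVars n → ℂ)} {y : MatMulVars n → ℂ}
    (h : E.TranslatesTo Δ E') (hΔ : E.Flattens y Δ) : E'.FlatAt y := fun γ hγ =>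
  (h.globalTangent_iff γ).mpr
    (hΔ γ ((h.jacobianC_mulVec_eq_zero_iff y γ).mp hγ).1 ((h.jacobianC_mulVec_eq_zero_iff y γ).mp hγ).2)

/-! ## Finite flattening: `≤ n²` translates always suffice -/

/-- The subspace `N(y) ∩ ⋂_{δ ∈ Δ} N(y + δ)` of `ℂ^{n²}`. -/
def transKer (E : EqSystem n) (y : MatMulVars n → ℂ) (Δ : List (MatMulVars n → ℂ)) :
    Submodule ℂ (Fin n × Fin n → ℂ) where
  carrier := {γ | (E.jacobianC (graphPoint y)).mulVec γ = 0 ∧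
    ∀ δ ∈ Δ, (E.jacobianC (graphPoint (y + δ))).mulVec γ = 0}
  zero_mem' := ⟨Matrix.mulVec_zero _, fun _ _ => Matrix.mulVec_zero _⟩
  add_mem' := by
    rintro γ γ' ⟨h0, hΔ⟩ ⟨h0', hΔ'⟩
    exact ⟨by rw [Matrix.mulVec_add, h0, h0', add_zero],
      fun δ hδ => by rw [Matrix.mulVec_add, hΔ δ hδ, hΔ' δ hδ, add_zero]⟩
  smul_mem' := by
    rintro c γ ⟨h0, hΔ⟩
    exact ⟨by rw [Matrix.mulVec_smul, h0, smul_zero],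
      fun δ hδ => by rw [Matrix.mulVec_smul, hΔ δ hδ, smul_zero]⟩

/-- Membership in `transKer`. -/
theorem mem_transKer_iff (E : EqSystem n) (y : MatMulVars n → ℂ) (Δ : List (MatMulVars n → ℂ))
    (γ : Fin n × Fin n → ℂ) :
    γ ∈ E.transKer y Δ ↔ (E.jacobianC (graphPoint y)).mulVec γ = 0 ∧
      ∀ δ ∈ Δ, (E.jacobianC (graphPoint (y + δ))).mulVec γ = 0 := Iff.rfl

/-- `Flattens` in terms of `transKer`. -/
theorem flattens_iff_transKer (E : EqSystem n) (y : MatMulVars n → ℂ) (Δ : List (MatMulVars n → ℂ)) :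
    E.Flattens y Δ ↔ ∀ γ ∈ E.transKer y Δ, E.GlobalTangent γ :=
  ⟨fun h γ hγ => h γ hγ.1 hγ.2, fun h γ h0 hΔ => h γ ⟨h0, hΔ⟩⟩

/-- Adjoining a translate shrinks the subspace. -/
theorem transKer_cons_le (E : EqSystem n) (y δ : MatMulVars n → ℂ) (Δ : List (MatMulVars n → ℂ)) :
    E.transKer y (δ :: Δ) ≤ E.transKer y Δ :=
  fun _ ⟨h0, hΔ⟩ => ⟨h0, fun δ' hδ' => hΔ δ' (List.mem_cons_of_mem δ hδ')⟩

/-- The descending-chain step: from a list whose subspace has dimension `≤ d`, at most `d` more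
translates flatten. -/
theorem exists_flattening_aux (E : EqSystem n) (y : MatMulVars n → ℂ) :
    ∀ (d : ℕ) (Δ : List (MatMulVars n → ℂ)), Module.finrank ℂ (E.transKer y Δ) ≤ d →
      ∃ Δ' : List (MatMulVars n → ℂ), Δ'.length ≤ Δ.length + d ∧ E.Flattens y Δ'
  | 0, Δ, hd => by
    refine ⟨Δ, by simp, (E.flattens_iff_transKer y Δ).mpr fun γ hγ => ?_⟩
    have hbot : E.transKer y Δ = ⊥ := Submodule.finrank_eq_zero.mp (Nat.le_zero.mp hd)
    rw [hbot, Submodule.mem_bot] at hγ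
    subst hγ
    exact fun _ => Matrix.mulVec_zero _
  | d + 1, Δ, hd => by
    classical
    by_cases hflat : E.Flattens y Δ
    · exact ⟨Δ, by omega, hflat⟩
    obtain ⟨γ, hγ, hG⟩ : ∃ γ, γ ∈ E.transKer y Δ ∧ ¬ E.GlobalTangent γ := by
      by_contra hc
      push Not at hc
      exact hflat ((E.flattens_iff_transKer y Δ).mpr hc)
    obtain ⟨y', hy'⟩ : ∃ y', (E.jacobianC (graphPoint y')).mulVec γ ≠ 0 := by
      by_contra hc
      push Not at hc
      exact hG hc
    have hlt : E.transKer y ((y' - y) :: Δ) < E.transKer y Δ := by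
      refine lt_of_le_of_ne (E.transKer_cons_le y _ Δ) fun heq => hy' ?_
      have hγ' : γ ∈ E.transKer y ((y' - y) :: Δ) := heq ▸ hγ
      have h := hγ'.2 (y' - y) List.mem_cons_self
      rwa [add_sub_cancel] at h
    have hd' : Module.finrank ℂ (E.transKer y ((y' - y) :: Δ)) ≤ d :=
      Nat.lt_succ_iff.mp (lt_of_lt_of_le (Submodule.finrank_lt_finrank_of_lt hlt) hd)
    obtain ⟨Δ', hlen, hflat'⟩ := exists_flattening_aux E y d _ hd'
    exact ⟨Δ', by simp only [List.length_cons] at hlen; omega, hflat'⟩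

/-- **FINITE FLATTENING.**  For every system `E` and base pair `y` some list of at most `n²` base
translations flattens `E` over `y`: `N(y) ∩ ⋂_{δ ∈ Δ} N(y + δ)` is the global tangent space. -/
theorem exists_flattening (E : EqSystem n) (y : MatMulVars n → ℂ) :
    ∃ Δ : List (MatMulVars n → ℂ), Δ.length ≤ n * n ∧ E.Flattens y Δ := by
  have hd : Module.finrank ℂ (E.transKer y []) ≤ n * n := by
    refine (Submodule.finrank_le _).trans ?_
    rw [Module.finrank_fintype_fun_eq_card, Fintype.card_prod, Fintype.card_fin]
  obtain ⟨Δ, hlen, hflat⟩ := E.exists_flattening_aux y (n * n) [] hd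
  exact ⟨Δ, by simpa using hlen, hflat⟩

/-! ## R1 on untwisted systems -/

/-- **R1 ON UNTWISTED SYSTEMS.**  A correct pair `(E, y)` with test ideal initially isolated to
order `2` over `y` has, for every fan-in-two system `E'` realising the translates of `E` along a
list flattening `E` over `y`, a CORRECT deflation REDUCED at `graphPoint y` of cost
`≤ 4·cost E' + n²` — the translated system is flat, hence const-deflatable (M16a). -/
theorem exists_reduced_deflation_of_translatesTo {E E' : EqSystem n} {Δ : List (MatMulVars n → ℂ)}
    {y : MatMulVars n → ℂ} (hE : E.Correct) (hiso : E.IdealInitIsolatedAt 2 y) (hΔ : E.Flattens y Δ)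
    (hfan : E'.circuit.IsFanInTwo) (h : E.TranslatesTo Δ E') :
    ∃ E'' : EqSystem n, E''.Correct ∧ E''.ReducedAt (graphPoint y) ∧ E''.cost ≤ 4 * E'.cost + n * n :=
  exists_reduced_deflation_of_flatAt (h.correct hE hfan) (h.idealInitIsolatedAt hiso) (h.flatAt hΔ)

/-- **The translated system along a flattening list is CONST-DEFLATABLE** (the class of M16a). -/
theorem TranslatesTo.constDeflatable {E E' : EqSystem n} {Δ : List (MatMulVars n → ℂ)}
    {y : MatMulVars n → ℂ} (h : E.TranslatesTo Δ E') (hE : E.Correct) (hfan : E'.circuit.IsFanInTwo)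
    (hiso : E.IdealInitIsolatedAt 2 y) (hΔ : E.Flattens y Δ) : E'.ConstDeflatable y :=
  ConstDeflatable.of_flatAt (h.correct hE hfan) (h.idealInitIsolatedAt hiso) (h.flatAt hΔ)

/-- **UNTWISTING THEOREM (qualitative completeness of the translation move).**  Every correct
order-`2` pair `(E, y)` admits a list of at most `n²` base translations such that ANY fan-in-two
realisation `E'` of the translates deflates to a correct system reduced at `graphPoint y`, at cost
`≤ 4·cost E' + n²`.  Twisting is an obstruction to COST only, never to EXISTENCE. -/
theorem untwisting {E : EqSystem n} {y : MatMulVars n → ℂ} (hE : E.Correct)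
    (hiso : E.IdealInitIsolatedAt 2 y) :
    ∃ Δ : List (MatMulVars n → ℂ), Δ.length ≤ n * n ∧
      ∀ E' : EqSystem n, E'.circuit.IsFanInTwo → E.TranslatesTo Δ E' →
        ∃ E'' : EqSystem n, E''.Correct ∧ E''.ReducedAt (graphPoint y) ∧
          E''.cost ≤ 4 * E'.cost + n * n := by
  obtain ⟨Δ, hlen, hflat⟩ := E.exists_flattening y
  exact ⟨Δ, hlen, fun E' hfan h => exists_reduced_deflation_of_translatesTo hE hiso hflat hfan h⟩

end EqSystem

end Summit.MatrixMultiplication.MatrixMultiplication.Theorems.GraphEquations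

end
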